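import Mathlib
import HarnessLib
import Summits.NavierStokesRegularity.NavierStokesRegularity.Theorems.TaylorModelRungThreeReadoutChainGlue
import Summits.NavierStokesRegularity.NavierStokesRegularity.Theorems.TaylorModelRungThreeVDefs

/-!
# Line `taylor-model` on crux K1b-DR (stmt-NavierStokesRegularity-23954) — G-side v3 toolkit 1: the flow
# property of a UNIQUE flow (selector appending / shifting / window congruence), for `IsFlowPackageV`

The v1 gluing lemmas of `…ReadoutChainGlue` (`solvesOn_of_vecSolution`, `stAt_add`, `solvesOn_append`) take the
v1 package `IsFlowPackage`; they use only its clauses (F0) (off-window components vanish) and (F2) (unconditional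
uniqueness against every solution).  The v3 package `IsFlowPackageV` has the same two clauses.  This file isolates
them as `IsUniqueFlow cd φ`, derives it from either package, and states the gluing lemmas against it in the ABSOLUTE-TIME /
window-vector forms the ports consume (proofs adapted from `…ReadoutChainGlue`), plus the restriction of a solved horizon and window congruence — what
the G-ports (G1-v node induction, G3-v κ-restart chains, G4-v last-sub-step calculus) use to move along sub-steps.

* `IsUniqueFlow`, `isUniqueFlow_of_package`, `isUniqueFlow_of_packageV`;
* `wsupp_stAtU`, `solvesOn_of_le`, `solvesOn_of_vecSolutionU` (window-vector form), `stAt_shiftU` and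
  `solvesOn_appendU` (absolute-time forms), `solvesOn_congr_windowU`.

MODEL-lattice rung TL-M3 only; nothing here is a statement about the Navier–Stokes equations.
-/

noncomputable section

-- the sub-problem namespace repeats the summit name by design (D-0017)
set_option linter.dupNamespace false

namespace Summit.NavierStokesRegularity.NavierStokesRegularity.Theorems.TaylorModelV

open Set Finset
open Literature.Analysis.FluidPDE.TaoCascade Literature.Analysis.FluidPDE.TaoCascade.TaylorChain
open Summit.NavierStokesRegularity.NavierStokesRegularity.Theorems.TaylorModelReadout

variable {cd : CertData} {bx : StepBoxes} {φ : Flow}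

/-- **Unique flow**: per stage, (F0) off-window components vanish and (F2) every solution of K1b-DR's ODE clause
on `[0,T]` from `z` coincides with `φ j z` on the window there. [folklore] -/
def IsUniqueFlow (cd : CertData) (φ : Flow) : Prop :=
  ∀ j, j ≤ cd.N₀ →
    (∀ (z : (Fin 4 → ℤ → ℝ)) i k, ¬(-cd.Kb ≤ k ∧ k ≤ cd.Ka) → ∀ t, φ j z i k t = 0) ∧
    (∀ (z : (Fin 4 → ℤ → ℝ)) (T : ℝ) (ψ : Fin 4 → ℤ → ℝ → ℝ), 0 ≤ T →
      (∀ i k, -cd.Kb ≤ k → k ≤ cd.Ka → ψ i k 0 = z i k ∧ ∀ t' ∈ Icc 0 T,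
        HasDerivWithinAt (ψ i k)
          (Literature.Analysis.FluidPDE.TaoCascade.quadTerm 1 cd.α
            (fun j' n s' => if -cd.Kb ≤ n ∧ n ≤ cd.Ka then ψ j' n s' else 0) i k t') (Icc 0 T) t') →
      ∀ i k, -cd.Kb ≤ k → k ≤ cd.Ka → ∀ t' ∈ Icc 0 T, ψ i k t' = φ j z i k t')

/-- The v1 package is a unique flow. [folklore] -/
theorem isUniqueFlow_of_package (hF : IsFlowPackage cd φ) : IsUniqueFlow cd φ :=
  fun j hj => ⟨(hF j hj).1, (hF j hj).2.2.1⟩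

/-- The v3 package is a unique flow. [folklore] -/
theorem isUniqueFlow_of_packageV (hF : IsFlowPackageV cd bx φ) : IsUniqueFlow cd φ :=
  fun j hj => ⟨(hF.2 j hj).1, (hF.2 j hj).2.1⟩

/-- **Restriction of a solved horizon.** [folklore] -/
theorem solvesOn_of_le {j : ℕ} {z : Fin 4 → ℤ → ℝ} {T T' : ℝ} (hsol : SolvesOn cd φ j z T) (hT' : T' ≤ T) :
    SolvesOn cd φ j z T' := by
  intro i k hk1 hk2
  refine ⟨(hsol i k hk1 hk2).1, fun t' ht' => ?_⟩
  exact ((hsol i k hk1 hk2).2 t' ⟨ht'.1, ht'.2.trans hT'⟩).mono (Icc_subset_Icc_right hT')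

section U

variable (hF : IsUniqueFlow cd φ) {j : ℕ} (hj : j ≤ cd.N₀)
include hF hj

/-- States of a unique flow are window-supported. [folklore] -/
theorem wsupp_stAtU (y : Fin 4 → ℤ → ℝ) (t : ℝ) : cd.Wsupp (stAt φ j y t) := fun i k hk => (hF j hj).1 y i k hk t

/-- **A window solution is the selector** (cf. `…ReadoutChainGlue.solvesOn_of_vecSolution` for the v1 package):
if `y` solves `x' = Qw x x` on `[0,T]` from `toVec q`, then `φ j q` solves K1b-DR's ODE clause on `[0,T]` and
`y t = toVec (stAt φ j q t)` there (window-vector form). [folklore] -/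
theorem solvesOn_of_vecSolutionU {q : Fin 4 → ℤ → ℝ} {T : ℝ} (hT : 0 ≤ T) {y : ℝ → Fin (nW cd) → ℝ}
    (hy0 : y 0 = toVec cd q) (hyd : ∀ t ∈ Icc 0 T, HasDerivWithinAt y (Qw cd (y t) (y t)) (Icc 0 T) t) :
    SolvesOn cd φ j q T ∧ ∀ t ∈ Icc 0 T, y t = toVec cd (stAt φ j q t) := by
  have hψ : ∀ i k, -cd.Kb ≤ k → k ≤ cd.Ka → (fun t => ofVec cd (y t) i k) 0 = q i k ∧
      ∀ t' ∈ Icc 0 T, HasDerivWithinAt (fun t => ofVec cd (y t) i k)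
        (quadTerm 1 cd.α (fun j' n s' => if -cd.Kb ≤ n ∧ n ≤ cd.Ka then (fun t => ofVec cd (y t) j' n) s' else 0)
          i k t') (Icc 0 T) t' := by
    intro i k hk1 hk2
    have hk : -cd.Kb ≤ k ∧ k ≤ cd.Ka := ⟨hk1, hk2⟩
    refine ⟨?_, fun t' ht' => ?_⟩
    · show ofVec cd (y 0) i k = q i k
      rw [hy0, ofVec_toVec, trunc_apply, if_pos hk]
    · rw [quadTerm_trunc_eq_qT (cd := cd) _ _ hk, qT_eq_Qw_apply (cd := cd) _ _ hk]
      have h1 := (hasDerivWithinAt_pi.1 (hyd t' ht')) (eW cd (i, ⟨k, Finset.mem_Icc.2 hk⟩))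
      have h2 : (fun t => ofVec cd (y t) i k) = fun t => y t (eW cd (i, ⟨k, Finset.mem_Icc.2 hk⟩)) := by
        funext t; exact ofVec_apply_of_mem cd (y t) i hk
      rw [h2]
      have h3 : toVec cd (fun j' n => ofVec cd (y t') j' n) = y t' := toVec_ofVec cd (y t')
      rw [h3]
      exact h1
  have hident := (hF j hj).2 q T (fun i k t => ofVec cd (y t) i k) hT hψ
  refine ⟨fun i k hk1 hk2 => ⟨?_, fun t' ht' => ?_⟩, fun t ht => ?_⟩
  · rw [← hident i k hk1 hk2 0 ⟨le_rfl, hT⟩]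
    exact (hψ i k hk1 hk2).1
  · have hk : -cd.Kb ≤ k ∧ k ≤ cd.Ka := ⟨hk1, hk2⟩
    have h1 := (hψ i k hk1 hk2).2 t' ht'
    rw [quadTerm_trunc_eq_qT (cd := cd) _ _ hk] at h1 ⊢
    have h2 : (fun j' n => (fun t => ofVec cd (y t) j' n) t') = stAt φ j q t' := by
      funext i' k'
      show ofVec cd (y t') i' k' = stAt φ j q t' i' k'
      by_cases hk' : -cd.Kb ≤ k' ∧ k' ≤ cd.Ka
      · exact hident i' k' hk'.1 hk'.2 t' ht'
      · rw [ofVec_apply_of_not_mem cd _ i' hk']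
        exact ((hF j hj).1 q i' k' hk' t').symm
    rw [h2] at h1
    exact h1.congr_of_mem (fun t ht => by
      show φ j q i k t = ofVec cd (y t) i k
      exact (hident i k hk1 hk2 t ht).symm) ht'
  · funext c
    have hk := shellOf_mem cd c
    have h1 := hident (modeOf cd c) (shellOf cd c) hk.1 hk.2 t ht
    rw [ofVec_apply_of_mem cd (y t) _ hk] at h1
    have hc : eW cd (modeOf cd c, ⟨shellOf cd c, Finset.mem_Icc.2 hk⟩) = c := Equiv.apply_symm_apply (eW cd) c
    rw [hc] at h1
    rw [h1]
    rfl

/-- **Flow property, absolute-time form** (cf. `…ReadoutChainGlue.stAt_add` for the v1 package): if `φ j q` solves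
on `[0,T]` and `t ∈ [0,T]`, then `φ j (stAt φ j q t)` solves on `[0, T − t]` and
`stAt φ j q s = stAt φ j (stAt φ j q t) (s − t)` for `s ∈ [t, T]`. [folklore] -/
theorem stAt_shiftU {q : Fin 4 → ℤ → ℝ} {T : ℝ} (hsol : SolvesOn cd φ j q T) {t : ℝ} (ht : t ∈ Icc 0 T) :
    SolvesOn cd φ j (stAt φ j q t) (T - t) ∧
      ∀ s ∈ Icc t T, stAt φ j q s = stAt φ j (stAt φ j q t) (s - t) := by
  have hT : 0 ≤ T - t := sub_nonneg.2 ht.2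
  have hy0 : (fun u => toVec cd (stAt φ j q (t + u))) 0 = toVec cd (stAt φ j q t) := by
    show toVec cd (stAt φ j q (t + 0)) = toVec cd (stAt φ j q t)
    rw [add_zero]
  have hyd : ∀ u ∈ Icc 0 (T - t), HasDerivWithinAt (fun u => toVec cd (stAt φ j q (t + u)))
      (Qw cd (toVec cd (stAt φ j q (t + u))) (toVec cd (stAt φ j q (t + u)))) (Icc 0 (T - t)) u := by
    intro u hu
    have h1 := hasDerivWithinAt_toVec_stAt hsol (u := t + u) ⟨by linarith [ht.1, hu.1], by linarith [hu.2]⟩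
    have h2 := hasDerivWithinAt_comp_const_add (c := t) (x := u) h1
    rw [zero_sub] at h2
    exact h2.mono (fun y hy => ⟨by linarith [hy.1, ht.1], hy.2⟩)
  obtain ⟨hs, hid⟩ := solvesOn_of_vecSolutionU hF hj hT hy0 hyd
  refine ⟨hs, fun s hs' => ?_⟩
  have h1 := hid (s - t) ⟨by linarith [hs'.1], by linarith [hs'.2]⟩
  have e : t + (s - t) = s := by ring
  simp only [e] at h1
  have h2 := congrArg (ofVec cd) h1
  rwa [ofVec_toVec_of_wsupp cd (wsupp_stAtU hF hj _ _), ofVec_toVec_of_wsupp cd (wsupp_stAtU hF hj _ _)] at h2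

/-- **Appending, absolute-time form** (cf. `…ReadoutChainGlue.solvesOn_append` for the v1 package): if `φ j z`
solves on `[0,T₁]` and `φ j (stAt φ j z T₁)` solves on `[0,T₂]` then `φ j z` solves on `[0, T₁+T₂]` and
`stAt φ j z s = stAt φ j (stAt φ j z T₁) (s − T₁)` for `s ∈ [T₁, T₁+T₂]`. [folklore] -/
theorem solvesOn_appendU {z : Fin 4 → ℤ → ℝ} {T₁ T₂ : ℝ} (hT₁ : 0 ≤ T₁) (hT₂ : 0 ≤ T₂)
    (h1 : SolvesOn cd φ j z T₁) (h2 : SolvesOn cd φ j (stAt φ j z T₁) T₂) :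
    SolvesOn cd φ j z (T₁ + T₂) ∧
      ∀ s ∈ Icc T₁ (T₁ + T₂), stAt φ j z s = stAt φ j (stAt φ j z T₁) (s - T₁) := by
  obtain ⟨α, hαd⟩ : ∃ α : ℝ → Fin (nW cd) → ℝ, α = fun u => toVec cd (stAt φ j z u) := ⟨_, rfl⟩
  obtain ⟨β, hβd⟩ : ∃ β : ℝ → Fin (nW cd) → ℝ,
      β = fun u => toVec cd (stAt φ j (stAt φ j z T₁) (-T₁ + u)) := ⟨_, rfl⟩
  have hα : ∀ t ∈ Icc 0 T₁, HasDerivWithinAt α ((fun (_ : ℝ) (x : Fin (nW cd) → ℝ) => Qw cd x x) t (α t))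
      (Icc 0 T₁) t := by
    intro t ht
    rw [hαd]
    exact hasDerivWithinAt_toVec_stAt h1 ht
  have hβ : ∀ t ∈ Icc T₁ (T₁ + T₂), HasDerivWithinAt β ((fun (_ : ℝ) (x : Fin (nW cd) → ℝ) => Qw cd x x) t (β t))
      (Icc T₁ (T₁ + T₂)) t := by
    intro t ht
    have h3 := hasDerivWithinAt_toVec_stAt h2 (u := -T₁ + t) ⟨by linarith [ht.1], by linarith [ht.2]⟩
    have h4 := hasDerivWithinAt_comp_const_add (c := -T₁) (x := t) h3
    have e1 : (0 : ℝ) - -T₁ = T₁ := by ring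
    have e2 : T₂ - -T₁ = T₁ + T₂ := by ring
    rw [e1, e2] at h4
    rw [hβd]
    exact h4
  have hjoin : α T₁ = β T₁ := by
    rw [hαd, hβd]
    show toVec cd (stAt φ j z T₁) = toVec cd (stAt φ j (stAt φ j z T₁) (-T₁ + T₁))
    rw [neg_add_cancel, toVec_stAt_zero h2]
  have happ := Literature.Analysis.ODE.solution_append (v := fun (_ : ℝ) (x : Fin (nW cd) → ℝ) => Qw cd x x)
    hα hβ hT₁ (le_add_of_nonneg_right hT₂) hjoin
  obtain ⟨w, hwd'⟩ : ∃ w : ℝ → Fin (nW cd) → ℝ, w = fun s => if s ≤ T₁ then α s else β s := ⟨_, rfl⟩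
  have hwd : ∀ t ∈ Icc 0 (T₁ + T₂), HasDerivWithinAt w (Qw cd (w t) (w t)) (Icc 0 (T₁ + T₂)) t := by
    intro t ht
    rw [hwd']
    exact happ t ht
  have hw0 : w 0 = toVec cd z := by
    rw [hwd']
    show (if (0 : ℝ) ≤ T₁ then α 0 else β 0) = toVec cd z
    rw [if_pos hT₁, hαd]
    exact toVec_stAt_zero h1
  obtain ⟨hs, hid⟩ := solvesOn_of_vecSolutionU hF hj (by linarith) hw0 hwd
  refine ⟨hs, fun s' hs' => ?_⟩
  have h5 := hid s' ⟨by linarith [hs'.1], hs'.2⟩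
  have h6 : w s' = toVec cd (stAt φ j (stAt φ j z T₁) (s' - T₁)) := by
    rw [hwd']
    show (if s' ≤ T₁ then α s' else β s') = toVec cd (stAt φ j (stAt φ j z T₁) (s' - T₁))
    by_cases hle : s' ≤ T₁
    · have hu0 : s' = T₁ := le_antisymm hle hs'.1
      rw [if_pos hle, hαd, hu0, sub_self]
      exact (toVec_stAt_zero h2).symm
    · rw [if_neg hle, hβd]
      show toVec cd (stAt φ j (stAt φ j z T₁) (-T₁ + s')) = toVec cd (stAt φ j (stAt φ j z T₁) (s' - T₁))
      rw [neg_add_eq_sub]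
  rw [h6] at h5
  have h7 := congrArg (ofVec cd) h5
  rwa [ofVec_toVec_of_wsupp cd (wsupp_stAtU hF hj _ _), ofVec_toVec_of_wsupp cd (wsupp_stAtU hF hj _ _),
    eq_comm] at h7

/-- **Window congruence**: data agreeing on the window have the same solved trajectory (if one of them solves
on `[0,T]`, so does the other, with the same states). [folklore] -/
theorem solvesOn_congr_windowU {z z' : Fin 4 → ℤ → ℝ} {T : ℝ} (hT : 0 ≤ T) (hsol : SolvesOn cd φ j z T)
    (hzz' : ∀ i k, -cd.Kb ≤ k → k ≤ cd.Ka → z i k = z' i k) :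
    SolvesOn cd φ j z' T ∧ ∀ t ∈ Icc 0 T, stAt φ j z' t = stAt φ j z t := by
  have hy0 : (fun u => toVec cd (stAt φ j z u)) 0 = toVec cd z' := by
    show toVec cd (stAt φ j z 0) = toVec cd z'
    rw [toVec_stAt_zero hsol]
    funext c
    simp only [toVec]
    exact hzz' _ _ (shellOf_mem cd c).1 (shellOf_mem cd c).2
  obtain ⟨hs, hid⟩ := solvesOn_of_vecSolutionU hF hj hT hy0 (fun t ht => hasDerivWithinAt_toVec_stAt hsol ht)
  refine ⟨hs, fun t ht => ?_⟩
  have h1 := congrArg (ofVec cd) (hid t ht)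
  rwa [ofVec_toVec_of_wsupp cd (wsupp_stAtU hF hj _ _), ofVec_toVec_of_wsupp cd (wsupp_stAtU hF hj _ _),
    eq_comm] at h1

end U

end Summit.NavierStokesRegularity.NavierStokesRegularity.Theorems.TaylorModelV

end
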